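import Mathlib
import HarnessLib
import Literature.MathematicalPhysics.QuantumFieldTheory.Balaban1983to89.B10Thm2Exactness

/-!
# `Balaban1983to89.B10Eq59Localization` — [Balaban1985UV3] p. 270, the two localisation sentences before **(59)**:
# *"Terms with localization domains X having non-empty intersections with Ω^c_{k+1} are estimated by O(g_k)|Z_k|.
# Terms with domains X, which are not contained in a cube of the size R(g_k)M₁, are estimated by
# O((L^kε)^{3+κ₀})|T₁^{(k)}|."* (and the k = 0 twin, pp. 264–265) — PROVED at one scale from the decay (25) over the
# cube carriers of `B12TreeDecay`, and assembled into the SHAPE of the cell leaf `B10Assembly.VacuumWholeRaw`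

T. Bałaban, *Ultraviolet stability of three-dimensional lattice pure gauge field theories*, Commun. Math. Phys. **102**,
255–275 (1985) [Balaban1985UV3] (cell paper B10; lit key `paper:balaban1985-cmp102-uv-stability-3d`, journal page =
PDF page + 254; pages re-read for this file on the renders
`run/shared/lean/pub/pub-balaban/b2b-balaban-ref1/pages/1985-cmp102-uv-stability-3d/…-p016-x2.png` (p. 270),
`…-p008-x2.png` (p. 262) and `…-p010/011-x2.png` (pp. 264–265), 2026-08-21).

HONEST FRAMING (mega-formalization `lit-balaban`, verbatim): statement-level skeleton of published theorems with
citation tags; proofs where landed; nothing here is a claim about the Yang–Mills mass gap.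

WHY THIS FILE EXISTS.  Unit `lit-balaban-r07` (reader/typer of B10), gen 6; SKELETON row B10.Eq59 (and the
*"whole counterterm"* sentence of rows B10.Eq24/B10.Eq35).  The cell module `…B10Assembly` carries the two sentences
as the HYPOTHESIS-SHAPED leaf `B10Assembly.VacuumWholeRaw P Cv Craw r₀ R₁ vol :
∀ h, |P.PprT − P.Ppr1 h| ≤ Cv·g_k·|Z_k| + Craw·exp(−R₁r(g_k))·vol h` (docstring: *"TYPING … A leaf, not a claim"*),
and kernel-checks only the arithmetic `exp(−R) ↦ O((L^kε)^{3+κ₀})` downstream of it (`vacuumWhole_of_raw`,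
`largeLoc_le_rpow`).  This module DERIVES that shape, at one scale, from the decay bound (25) p. 262 (typed
`B10.Bound25Printed`: `|𝒫′(X, U)| ≤ C·g·e^{−κ𝓛(X)}`) over the located carriers of `B12TreeDecay` (localization
domains = connected families of big blocks, tree length 𝓛): the first sentence is the TOUCHING form of (1.26)
[Balaban1988RG2Cluster] (`B10Thm2Exactness.sum_abs_act_touching_le_of_bound25`, from
`B12TreeDecay.ineq126_touches`) with `Y` = the blocks of `Z_k = Ω_{k+1}ᶜ`; the second is the OFF-DIAGONAL form
(`B12TreeDecay.offDiag_le`: the sub-sum of (1.26) over `𝓛(X) ≥ R` is `≤ e^{−(κ−κ₀)R}K₀` per anchor) summed over the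
anchors, *"not contained in a cube of the size R(g_k)M₁"* being read through the tree length as `𝓛(X) ≥ R`
(p. 262: *"if X is not contained in a cube of the size RM₁, then the exponential factor in (23) yields the factor
exp(−R)"* — blocks scaled to unit cubes, so such an X has a tree of length ≥ R; the cube geometry itself is not
modelled, cell DIVERGENCE F5, hence the threshold form).

THE PRINTED TEXT.  p. 270 [16], verbatim: *"We analyse the perturbative expressions in the same way as in the first
step. We expand all the propagators into the generalized random walk expansions. We get a sum of terms, each having
a localization domain X. Terms with localization domains X having non-empty intersections with Ω^c_{k+1} are
estimated by O(g_k)|Z_k|. Terms with domains X, which are not contained in a cube of the size R(g_k)M₁, are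
estimated by O((L^kε)^{3+κ₀})|T₁^{(k)}|. The remaining terms give the sum (59) Σ_X 𝒫′_{k+1}(g_k, X, U_{k+1}) over
localizations X ⊂ Ω_{k+1}, which are connected unions of big blocks, and which are contained in cubes of the size
R(g_k)M₁. The terms 𝒫′_{k+1} satisfy the bound (25) (with the indices 1, 0 replaced by k + 1, k)"*.  pp. 264–265
[10–11] (k = 0): *"To obtain the whole counterterm we have to add a sum of the corresponding terms with localizations
X satisfying X ∩ Ω₁ᶜ ≠ ∅. This sum can be bounded by O(g₀)|Ω₁ᶜ|."*  p. 262 [8]: *"(25) |𝒫′₁(g₀, X, U₁)| ≤ O(g₀)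
exp(−κ𝓛(X)), where κ can be arbitrarily large if M₁ is sufficiently large"*.

DICTIONARY print ↦ Lean.  One scale: localization domains `X` ↦ `X : S.Dom` (`S : LocDomainSys`, `S.dj` = 𝓛), their
big blocks ↦ `G.cubes X` (`G : CubeSystem S`), `Ω_{k+1}` as a union of big blocks ↦ `Ω : Finset G.Cube`, the blocks of
`Z_k = Ω_{k+1}ᶜ` ↦ `univ ∖ Ω`; *"X having non-empty intersection with Ω^c_{k+1}"* ↦ `(G.cubes X ∩ (univ ∖ Ω)).Nonempty`;
*"X not contained in a cube of the size R(g_k)M₁"* ↦ `R ≤ S.dj X` (threshold reading, above); the activities ↦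
`act : S.Dom → Cfg → ℝ` with `B10.Bound25Printed ⟨S.Dom, Cfg, S.dj, act⟩ g κ C` (`g = g_k`); `PprT` (all terms) ↦
`Σ_X act X U`; `Ppr1` (the retained sum (59): `X ⊂ Ω_{k+1}` and small) ↦ `Σ_{X ⊆ Ω, 𝓛(X) < R} act X U`; `|Z_k|` ↦ any
`Zvol ≥ #(univ ∖ Ω)`; `vol` ↦ `#blocks = Fintype.card G.Cube` (≤ `|T₁^{(k)}|`).

WHAT THIS FILE PROVES (kernel, no `sorry`, theorems only, no new definitions or named facts; axioms standard).
* `sum_filter_le_sum_anchors` — an anchored union bound: `Σ_{X : P X} f(X) ≤ Σ_□ Σ_{X ∋ □, P X} f(X)` for `f ≥ 0`.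
* `sum_exp_large_le` — `Σ_{X : 𝓛(X) ≥ R} e^{−κ𝓛(X)} ≤ e^{−(κ−κ₀(c₀,Δ))R}·K₀(c₀,Δ)·#blocks` (from `offDiag_le`).
* `sum_abs_act_large_le_of_bound25` — **second sentence**: `Σ_{X : 𝓛(X) ≥ R} |𝒫′(X,U)| ≤ C·g·K₀·e^{−(κ−κ₀)R}·#blocks`.
* `sum_abs_act_outside_le_of_bound25` — **first sentence**: `Σ_{X ∩ Z ≠ ∅} |𝒫′(X,U)| ≤ (C·K₀)·g·#Z` (`Z = univ ∖ Ω`;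
  the printed `O(g_k)|Z_k|` with O(1) = `C·K₀(c₀,Δ)`), by name from `B10Thm2Exactness`.
* `total_sub_retained_eq` — `Σ_X − Σ_{X ⊆ Ω, 𝓛 < R} = Σ_{X ⊄ Ω} + Σ_{X ⊆ Ω, 𝓛 ≥ R}` (exact splitting).
* `vacuumWholeRaw_shape_of_bound25` — **the shape of `B10Assembly.VacuumWholeRaw`**:
  `|Σ_X 𝒫′ − Σ_{X ⊆ Ω, 𝓛 < R} 𝒫′| ≤ (C·K₀)·g·Zvol + (C·g·K₀·#blocks)·e^{−(κ−κ₀)R}`, and `…_exp_neg_R`: for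
  `κ ≥ κ₀ + 1`, `R ≥ 0` the last factor is `≤ e^{−R}` — literally `Cv·g_k·|Z_k| + Craw·exp(−R)·vol` with `Cv = C·K₀`,
  `Craw = C·g·K₀`, `vol = #blocks`, `R = R(g_k) = R₁r(g_k)`.

Value = SKELETON row B10.Eq59 gains kernel-checked members at one scale (modulo (25) and the volume leaf); the b2b leaf
`VacuumWholeRaw` is derived in shape from (25).  NOT summit progress.
-/

noncomputable section

open Finset
open Literature.MathematicalPhysics.QuantumFieldTheory.Balaban1983to89
open Literature.MathematicalPhysics.QuantumFieldTheory.Balaban1983to89.B12TreeDecay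
  (CubeSystem kappa₀ K₀ K₀_pos ineq126_touches offDiag_le sum_touches_le)

namespace Literature.MathematicalPhysics.QuantumFieldTheory.Balaban1983to89.B10Eq59Localization

/-! ## §1 Large localizations: the off-diagonal form of (1.26) summed over the anchors -/

section Large

variable {S : LocDomainSys} (G : CubeSystem S) {Δ : ℕ} {c₀ κ g C : ℝ} {Cfg : Type}

/-- Anchored union bound: every localization domain lies above at least one big block, so for `f ≥ 0` and any
predicate `P`, `Σ_{X : P X} f(X) ≤ Σ_□ Σ_{X ∋ □, P X} f(X)` (`B12TreeDecay.sum_touches_le` with `Y` = all blocks and the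
weight `f·𝟙_P`). [cite: Balaban1985UV3, (59) p.270] -/
theorem sum_filter_le_sum_anchors (P : S.Dom → Prop) [DecidablePred P] (f : S.Dom → ℝ) (hf : ∀ X, 0 ≤ f X) :
    ∑ X ∈ Finset.univ.filter P, f X ≤ ∑ c : G.Cube, ∑ X ∈ (G.above c).filter P, f X := by
  classical
  have h := sum_touches_le G (Finset.univ : Finset G.Cube) (fun X => if P X then f X else 0)
    (fun X => by split_ifs <;> simp [hf X])
  have hall : (Finset.univ.filter fun X : S.Dom => (G.cubes X ∩ (Finset.univ : Finset G.Cube)).Nonempty)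
      = Finset.univ :=
    Finset.filter_true_of_mem fun X _ => by
      rw [Finset.inter_univ]
      exact (G.connected X).1
  rw [hall, ← Finset.sum_filter] at h
  refine h.trans (le_of_eq ?_)
  refine Finset.sum_congr rfl fun c _ => ?_
  rw [Finset.sum_filter]

/-- `Σ_{X : 𝓛(X) ≥ R} e^{−κ𝓛(X)} ≤ e^{−(κ−κ₀(c₀,Δ))R}·K₀(c₀,Δ)·#blocks` — the off-diagonal form of (1.26)
(`B12TreeDecay.offDiag_le`, per anchor) summed over the `#blocks` anchors. [cite: Balaban1985UV3, (59) p.270] -/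
theorem sum_exp_large_le (hΔ : G.DegreeLE Δ) (hV : G.VolumeLeaf c₀) (hκ : kappa₀ c₀ Δ ≤ κ) (R : ℝ) :
    ∑ X ∈ Finset.univ.filter (fun X : S.Dom => R ≤ S.dj X), Real.exp (-κ * S.dj X)
      ≤ Real.exp (-(κ - kappa₀ c₀ Δ) * R) * K₀ c₀ Δ * Fintype.card G.Cube := by
  classical
  calc ∑ X ∈ Finset.univ.filter (fun X : S.Dom => R ≤ S.dj X), Real.exp (-κ * S.dj X)
      ≤ ∑ c : G.Cube, ∑ X ∈ (G.above c).filter (fun X : S.Dom => R ≤ S.dj X), Real.exp (-κ * S.dj X) :=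
        sum_filter_le_sum_anchors G _ _ fun X => Real.exp_nonneg _
    _ ≤ ∑ _c : G.Cube, Real.exp (-(κ - kappa₀ c₀ Δ) * R) * K₀ c₀ Δ :=
        Finset.sum_le_sum fun c _ => offDiag_le G hΔ hV hκ c R
    _ = Real.exp (-(κ - kappa₀ c₀ Δ) * R) * K₀ c₀ Δ * Fintype.card G.Cube := by
        rw [Finset.sum_const, Finset.card_univ, nsmul_eq_mul]; ring

/-- **Second sentence of p. 270** (*"Terms with domains X, which are not contained in a cube of the size R(g_k)M₁, are
estimated by …"*), at one scale in the threshold reading `𝓛(X) ≥ R`: (25) ⇒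
`Σ_{X : 𝓛(X) ≥ R} |𝒫′(X, U)| ≤ C·g·K₀(c₀,Δ)·e^{−(κ−κ₀(c₀,Δ))R}·#blocks` — the printed mechanism *"the exponential factor
… yields the factor exp(−R)"* (p. 262) with the residual rate `κ − κ₀` explicit. [cite: Balaban1985UV3, (59) p.270 + (25) p.262] -/
theorem sum_abs_act_large_le_of_bound25 (hΔ : G.DegreeLE Δ) (hV : G.VolumeLeaf c₀) (hκ : kappa₀ c₀ Δ ≤ κ)
    (act : S.Dom → Cfg → ℝ) (hCg : 0 ≤ C * g) (h25 : B10.Bound25Printed ⟨S.Dom, Cfg, S.dj, act⟩ g κ C) (U : Cfg)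
    (R : ℝ) :
    ∑ X ∈ Finset.univ.filter (fun X : S.Dom => R ≤ S.dj X), |act X U|
      ≤ C * g * K₀ c₀ Δ * Real.exp (-(κ - kappa₀ c₀ Δ) * R) * Fintype.card G.Cube := by
  calc ∑ X ∈ Finset.univ.filter (fun X : S.Dom => R ≤ S.dj X), |act X U|
      ≤ ∑ X ∈ Finset.univ.filter (fun X : S.Dom => R ≤ S.dj X), C * g * Real.exp (-κ * S.dj X) :=
        Finset.sum_le_sum fun X _ => by rw [neg_mul]; exact h25 X U
    _ = C * g * ∑ X ∈ Finset.univ.filter (fun X : S.Dom => R ≤ S.dj X), Real.exp (-κ * S.dj X) := by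
        rw [Finset.mul_sum]
    _ ≤ C * g * (Real.exp (-(κ - kappa₀ c₀ Δ) * R) * K₀ c₀ Δ * Fintype.card G.Cube) :=
        mul_le_mul_of_nonneg_left (sum_exp_large_le G hΔ hV hκ R) hCg
    _ = C * g * K₀ c₀ Δ * Real.exp (-(κ - kappa₀ c₀ Δ) * R) * Fintype.card G.Cube := by ring

end Large

/-! ## §2 Localizations meeting `Z_k = Ω_{k+1}ᶜ`: the touching form -/

section Outside

variable {S : LocDomainSys} (G : CubeSystem S) {Δ : ℕ} {c₀ κ g C : ℝ} {Cfg : Type}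

/-- **First sentence of p. 270** (*"Terms with localization domains X having non-empty intersections with Ω^c_{k+1}
are estimated by O(g_k)|Z_k|"*; k = 0: pp. 264–265 *"X ∩ Ω₁ᶜ ≠ ∅ … bounded by O(g₀)|Ω₁ᶜ|"*), at one scale: with `Z`
the blocks of `Z_k`, (25) ⇒ `Σ_{X ∩ Z ≠ ∅} |𝒫′(X, U)| ≤ (C·K₀(c₀,Δ))·g·#Z` — the printed `O(g_k)|Z_k|`, O(1) = `C·K₀`
explicit (`B10Thm2Exactness.sum_abs_act_touching_le_of_bound25`). [cite: Balaban1985UV3, (59) p.270 + pp.264–265] -/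
theorem sum_abs_act_outside_le_of_bound25 (hΔ : G.DegreeLE Δ) (hV : G.VolumeLeaf c₀) (hκ : kappa₀ c₀ Δ ≤ κ)
    (act : S.Dom → Cfg → ℝ) (hCg : 0 ≤ C * g) (h25 : B10.Bound25Printed ⟨S.Dom, Cfg, S.dj, act⟩ g κ C) (U : Cfg)
    (Z : Finset G.Cube) :
    ∑ X ∈ Finset.univ.filter (fun X : S.Dom => (G.cubes X ∩ Z).Nonempty), |act X U| ≤ (C * K₀ c₀ Δ) * g * Z.card := by
  have h := B10Thm2Exactness.sum_abs_act_touching_le_of_bound25 G hΔ hV hκ act hCg h25 U Z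
  calc _ ≤ C * g * K₀ c₀ Δ * Z.card := h
    _ = (C * K₀ c₀ Δ) * g * Z.card := by ring

end Outside

/-! ## §3 The shape of `B10Assembly.VacuumWholeRaw` derived from (25) -/

section Shape

variable {S : LocDomainSys} (G : CubeSystem S) {Δ : ℕ} {c₀ κ g C : ℝ} {Cfg : Type}

/-- Exact splitting of the total polymer sum against the retained sum (59) (`X ⊂ Ω_{k+1}` and small):
`Σ_X 𝒫′ − Σ_{X ⊆ Ω, 𝓛(X) < R} 𝒫′ = Σ_{X ⊄ Ω} 𝒫′ + Σ_{X ⊆ Ω, 𝓛(X) ≥ R} 𝒫′`. [cite: Balaban1985UV3, (59) p.270] -/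
theorem total_sub_retained_eq (act : S.Dom → Cfg → ℝ) (U : Cfg) (Ω : Finset G.Cube) (R : ℝ) :
    ∑ X : S.Dom, act X U
        - ∑ X ∈ (Finset.univ.filter (fun X : S.Dom => G.cubes X ⊆ Ω)).filter (fun X => S.dj X < R), act X U =
      ∑ X ∈ Finset.univ.filter (fun X : S.Dom => ¬ G.cubes X ⊆ Ω), act X U
        + ∑ X ∈ (Finset.univ.filter (fun X : S.Dom => G.cubes X ⊆ Ω)).filter (fun X => ¬ S.dj X < R),
            act X U := by
  have h1 := Finset.sum_filter_add_sum_filter_not Finset.univ (fun X : S.Dom => G.cubes X ⊆ Ω) (fun X => act X U)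
  have h2 := Finset.sum_filter_add_sum_filter_not (Finset.univ.filter (fun X : S.Dom => G.cubes X ⊆ Ω))
    (fun X : S.Dom => S.dj X < R) (fun X => act X U)
  linarith

/-- The large retained-domain part is dominated by the sum over ALL large domains (nonnegative terms, smaller index
set). [cite: Balaban1985UV3, (59) p.270] -/
theorem sum_abs_inside_large_le (act : S.Dom → Cfg → ℝ) (U : Cfg) (Ω : Finset G.Cube) (R : ℝ) :
    ∑ X ∈ (Finset.univ.filter (fun X : S.Dom => G.cubes X ⊆ Ω)).filter (fun X => ¬ S.dj X < R), |act X U|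
      ≤ ∑ X ∈ Finset.univ.filter (fun X : S.Dom => R ≤ S.dj X), |act X U| := by
  refine Finset.sum_le_sum_of_subset_of_nonneg ?_ fun X _ _ => abs_nonneg _
  intro X hX
  simp only [Finset.mem_filter, Finset.mem_univ, true_and, not_lt] at hX ⊢
  exact hX.2

/-- **The shape of the cell leaf `B10Assembly.VacuumWholeRaw` DERIVED from (25)** at one scale: with `PprT = Σ_X 𝒫′(X,U)`
(all localizations), `Ppr1 = Σ_{X ⊆ Ω, 𝓛(X) < R} 𝒫′(X,U)` (the retained sum (59)), any `Zvol ≥ #(blocks ∖ Ω)` (the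
blocks of `Z_k`; a unit-lattice site count dominates it):
`|PprT − Ppr1| ≤ (C·K₀(c₀,Δ))·g·Zvol + (C·g·K₀(c₀,Δ)·#blocks)·e^{−(κ−κ₀(c₀,Δ))R}` — the two printed sentences of
p. 270 (k ≥ 1) / pp. 264–265 (k = 0) as ONE inequality.  Hypotheses: wall-degree ≤ Δ, the volume leaf, `κ ≥ κ₀(c₀,Δ)`
(*"κ can be arbitrarily large if M₁ is sufficiently large"*), `0 ≤ C·g`, (25). [cite: Balaban1985UV3, (59) p.270 + pp.264–265 + (25) p.262] -/
theorem vacuumWholeRaw_shape_of_bound25 (hΔ : G.DegreeLE Δ) (hV : G.VolumeLeaf c₀) (hκ : kappa₀ c₀ Δ ≤ κ)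
    (act : S.Dom → Cfg → ℝ) (hCg : 0 ≤ C * g) (h25 : B10.Bound25Printed ⟨S.Dom, Cfg, S.dj, act⟩ g κ C) (U : Cfg)
    (Ω : Finset G.Cube) (R : ℝ) {Zvol : ℝ} (hZ : ((Finset.univ \ Ω).card : ℝ) ≤ Zvol) :
    |∑ X : S.Dom, act X U
        - ∑ X ∈ (Finset.univ.filter (fun X : S.Dom => G.cubes X ⊆ Ω)).filter (fun X => S.dj X < R), act X U|
      ≤ (C * K₀ c₀ Δ) * g * Zvol
        + (C * g * K₀ c₀ Δ * Fintype.card G.Cube) * Real.exp (-(κ - kappa₀ c₀ Δ) * R) := by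
  rw [total_sub_retained_eq G act U Ω R]
  have hout : |∑ X ∈ Finset.univ.filter (fun X : S.Dom => ¬ G.cubes X ⊆ Ω), act X U| ≤ (C * K₀ c₀ Δ) * g * Zvol := by
    calc |∑ X ∈ Finset.univ.filter (fun X : S.Dom => ¬ G.cubes X ⊆ Ω), act X U|
        ≤ ∑ X ∈ Finset.univ.filter (fun X : S.Dom => ¬ G.cubes X ⊆ Ω), |act X U| := Finset.abs_sum_le_sum_abs _ _
      _ ≤ C * g * K₀ c₀ Δ * (Finset.univ \ Ω).card :=
          B10Thm2Exactness.sum_abs_act_notSubset_le_of_bound25 G hΔ hV hκ act hCg h25 U Ω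
      _ ≤ C * g * K₀ c₀ Δ * Zvol := mul_le_mul_of_nonneg_left hZ (mul_nonneg hCg (K₀_pos c₀ Δ).le)
      _ = (C * K₀ c₀ Δ) * g * Zvol := by ring
  have hlarge : |∑ X ∈ (Finset.univ.filter (fun X : S.Dom => G.cubes X ⊆ Ω)).filter (fun X => ¬ S.dj X < R),
      act X U| ≤ (C * g * K₀ c₀ Δ * Fintype.card G.Cube) * Real.exp (-(κ - kappa₀ c₀ Δ) * R) := by
    calc |∑ X ∈ (Finset.univ.filter (fun X : S.Dom => G.cubes X ⊆ Ω)).filter (fun X => ¬ S.dj X < R), act X U|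
        ≤ ∑ X ∈ (Finset.univ.filter (fun X : S.Dom => G.cubes X ⊆ Ω)).filter (fun X => ¬ S.dj X < R), |act X U| :=
          Finset.abs_sum_le_sum_abs _ _
      _ ≤ ∑ X ∈ Finset.univ.filter (fun X : S.Dom => R ≤ S.dj X), |act X U| := sum_abs_inside_large_le G act U Ω R
      _ ≤ C * g * K₀ c₀ Δ * Real.exp (-(κ - kappa₀ c₀ Δ) * R) * Fintype.card G.Cube :=
          sum_abs_act_large_le_of_bound25 G hΔ hV hκ act hCg h25 U R
      _ = (C * g * K₀ c₀ Δ * Fintype.card G.Cube) * Real.exp (-(κ - kappa₀ c₀ Δ) * R) := by ring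
  exact (abs_add_le _ _).trans (add_le_add hout hlarge)

/-- **`VacuumWholeRaw` literally:** for `κ ≥ κ₀(c₀,Δ) + 1` and `R ≥ 0` the residual factor is `≤ e^{−R}`, so
`|PprT − Ppr1| ≤ Cv·g·Zvol + Craw·e^{−R}·vol` with `Cv = C·K₀(c₀,Δ)`, `Craw = C·g·K₀(c₀,Δ)`, `vol = #blocks` — the shape
`|P.PprT − P.Ppr1 h| ≤ Cv·g_k·|Z_k| + Craw·exp(−R₁r(g_k))·vol h` of `B10Assembly.VacuumWholeRaw` at `R = R₁r(g_k)`
((7) p. 257, (39) p. 266), whose `exp(−R) ↦ O((L^kε)^{3+κ₀})` arithmetic is the pre-existing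
`B10Assembly.vacuumWhole_of_raw` / `largeLoc_le_rpow`. [cite: Balaban1985UV3, (59) p.270 + p.262] -/
theorem vacuumWholeRaw_shape_exp_neg_R (hΔ : G.DegreeLE Δ) (hV : G.VolumeLeaf c₀) (hκ : kappa₀ c₀ Δ + 1 ≤ κ)
    (act : S.Dom → Cfg → ℝ) (hCg : 0 ≤ C * g) (h25 : B10.Bound25Printed ⟨S.Dom, Cfg, S.dj, act⟩ g κ C) (U : Cfg)
    (Ω : Finset G.Cube) {R : ℝ} (hR : 0 ≤ R) {Zvol : ℝ} (hZ : ((Finset.univ \ Ω).card : ℝ) ≤ Zvol) :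
    |∑ X : S.Dom, act X U
        - ∑ X ∈ (Finset.univ.filter (fun X : S.Dom => G.cubes X ⊆ Ω)).filter (fun X => S.dj X < R), act X U|
      ≤ (C * K₀ c₀ Δ) * g * Zvol + (C * g * K₀ c₀ Δ * Fintype.card G.Cube) * Real.exp (-R) := by
  have hκ' : kappa₀ c₀ Δ ≤ κ := by linarith
  have h := vacuumWholeRaw_shape_of_bound25 G hΔ hV hκ' act hCg h25 U Ω R hZ
  have hexp : Real.exp (-(κ - kappa₀ c₀ Δ) * R) ≤ Real.exp (-R) :=
    Real.exp_le_exp.mpr (by nlinarith)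
  have hcoef : 0 ≤ C * g * K₀ c₀ Δ * Fintype.card G.Cube :=
    mul_nonneg (mul_nonneg hCg (K₀_pos c₀ Δ).le) (Nat.cast_nonneg _)
  exact h.trans (by nlinarith [mul_le_mul_of_nonneg_left hexp hcoef])

end Shape

end Literature.MathematicalPhysics.QuantumFieldTheory.Balaban1983to89.B10Eq59Localization

end
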